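import Literature.NumberTheory.DiophantineApproximation.UnitSquarePolynomialIntegrality
import Literature.NumberTheory.DiophantineApproximation.RhinViolaPolynomialCase
import Mathlib.Algebra.MvPolynomial.CommRing
import Mathlib.Algebra.MvPolynomial.Degrees
import HarnessLib

/-!
# Rhin–Viola 2005, Lemma 2.2 for `I_z^{(0)}`: `d_{m+h−k} d_{l+m−j} z^{l+m} I_z^{(0)} = T(z) ∈ ℤ[z]` when `j+k<m`

Topic `Literature/NumberTheory/DiophantineApproximation`. Everything here is PROVED (no definitions, no named
facts). Source: G. Rhin, C. Viola, *The permutation group method for the dilogarithm*, Ann. Sc. Norm. Super.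
Pisa (5) 4 (2005) 389–437, Lemma 2.2 (p. 395): if `j+k−m < 0` then the integrand
`x^j(1−x)^h y^k(1−y)^l (x(1−y)+yz)^{m−j−k−1} = S(x,y,z) ∈ ℤ[x,y,z]` has `deg_x S = m+h−k−1`, `deg_y S = l+m−j−1`,
and "`d_{m+h−k} d_{l+m−j} z^{l+m} I_z(h,j,k,l,m) = d_{H'} d_{K'} ∫₀¹∫₀¹ S(x,y,z) dx dy = T(z)` for some
polynomial `T(z) ∈ ℤ[z]`". We prove this for the real member `I_z^{(0)}` (`RhinViola.I0`; recall `I_z^{(1)} = 0`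
here, `RhinViola.I1_of_lt`), for every real `z ≥ 1`, with ONE integer polynomial `T` independent of `z`:
the integrand is the evaluation of an explicit `MvPolynomial (Fin 3) ℤ` whose partial degrees are bounded with
`MvPolynomial.degreeOf_mul_le` & co., a generic lemma turns `d_A d_B ∫∫_{[0,1]²} (aeval f)` into `aeval z T`
for any integer trivariate `f` with `deg_x f < A`, `deg_y f < B` (monomialwise: `∫∫ x^a y^b = 1/((a+1)(b+1))`,
`(a+1) ∣ d_A`), and `RhinViola.zpow_mul_I0_of_lt` identifies `z^{l+m} I0` with `∫∫ S`.

## References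

* G. Rhin, C. Viola, Ann. Sc. Norm. Super. Pisa Cl. Sci. (5) 4 (2005) 389–437, Lemma 2.2. [RhinViola2005]
-/

noncomputable section

namespace Literature.NumberTheory.DiophantineApproximation

namespace RhinViola

open _root_.MeasureTheory _root_.Set Finset
open ViolaZudilin (unitSquare denom₁ volume_restrict_unitSquare measurableSet_unitSquare isCompact_unitSquare)

/-! ### Integer trivariate polynomials on the unit square -/

/-- Evaluation of an integer trivariate polynomial at `(v₀, v₁, v₂)` as a finite sum of monomials. [folklore] -/
theorem aeval_eq_sum_coeff (f : MvPolynomial (Fin 3) ℤ) (v : Fin 3 → ℝ) :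
    MvPolynomial.aeval v f =
      ∑ d ∈ f.support, ((MvPolynomial.coeff d f : ℤ) : ℝ) * (v 0 ^ d 0 * v 1 ^ d 1 * v 2 ^ d 2) := by
  rw [MvPolynomial.aeval_def, MvPolynomial.eval₂_eq']
  refine sum_congr rfl fun d _ => ?_
  rw [Fin.prod_univ_three]
  simp

/-- **`d_A d_B ∫∫_{[0,1]²} f(x,y,z) dx dy = T(z)` with `T ∈ ℤ[z]`** for an integer polynomial `f(x,y,z)` with
`deg_x f < A`, `deg_y f < B` (`T = Σ_d coeff_d · (d_A/(d₀+1)) (d_B/(d₁+1)) · Z^{d₂}`).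
[cite: RhinViola2005, Lemma 2.2 (proof)] -/
theorem exists_poly_eq_lcm_mul_setIntegral_aeval (f : MvPolynomial (Fin 3) ℤ) {A B : ℕ}
    (hA : f.degreeOf 0 < A) (hB : f.degreeOf 1 < B) :
    ∃ T : Polynomial ℤ, ∀ z : ℝ, (Polynomial.aeval z T : ℝ) = (Nat.lcmUpto A : ℝ) * Nat.lcmUpto B *
      ∫ p in unitSquare, MvPolynomial.aeval ![p.1, p.2, z] f := by
  refine ⟨∑ d ∈ f.support, Polynomial.C (MvPolynomial.coeff d f * ((Nat.lcmUpto A : ℤ) / (d 0 + 1)) *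
    ((Nat.lcmUpto B : ℤ) / (d 1 + 1))) * Polynomial.X ^ (d 2), fun z => ?_⟩
  -- the integral, monomialwise
  have hint : ∫ p in unitSquare, MvPolynomial.aeval ![p.1, p.2, z] f =
      ∑ d ∈ f.support, ((MvPolynomial.coeff d f : ℤ) : ℝ) * z ^ d 2 / (((d 0 : ℝ) + 1) * ((d 1 : ℝ) + 1)) := by
    simp only [aeval_eq_sum_coeff, Matrix.cons_val_zero, Matrix.cons_val_one, Matrix.cons_val]
    rw [integral_finsetSum _ fun d _ => ?_]
    · refine sum_congr rfl fun d _ => ?_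
      have : (fun p : ℝ × ℝ => ((MvPolynomial.coeff d f : ℤ) : ℝ) * (p.1 ^ d 0 * p.2 ^ d 1 * z ^ d 2)) =
          fun p : ℝ × ℝ => ((MvPolynomial.coeff d f : ℤ) : ℝ) * z ^ d 2 * (p.1 ^ d 0 * p.2 ^ d 1) := by
        funext p; ring
      rw [this, integral_const_mul, setIntegral_unitSquare_pow_mul_pow]
      ring
    · have : (fun p : ℝ × ℝ => ((MvPolynomial.coeff d f : ℤ) : ℝ) * (p.1 ^ d 0 * p.2 ^ d 1 * z ^ d 2)) =
          fun p : ℝ × ℝ => ((MvPolynomial.coeff d f : ℤ) : ℝ) * z ^ d 2 * (p.1 ^ d 0 * p.2 ^ d 1) := by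
        funext p; ring
      rw [this]
      exact (integrableOn_unitSquare_pow_mul_pow _ _).const_mul _
  rw [hint, mul_sum, map_sum]
  refine sum_congr rfl fun d hd => ?_
  have h0 : d 0 + 1 ≤ A := by
    have := MvPolynomial.monomial_le_degreeOf 0 hd
    omega
  have h1 : d 1 + 1 ≤ B := by
    have := MvPolynomial.monomial_le_degreeOf 1 hd
    omega
  have hdA : ((d 0 + 1 : ℕ) : ℤ) ∣ (Nat.lcmUpto A : ℤ) := DilogPade.natCast_dvd_lcmUpto (by omega) h0
  have hdB : ((d 1 + 1 : ℕ) : ℤ) ∣ (Nat.lcmUpto B : ℤ) := DilogPade.natCast_dvd_lcmUpto (by omega) h1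
  have ha0 : ((d 0 : ℝ) + 1) ≠ 0 := by positivity
  have hb0 : ((d 1 : ℝ) + 1) ≠ 0 := by positivity
  simp only [map_mul, map_pow, Polynomial.aeval_X, eq_intCast, map_intCast]
  rw [Int.cast_div (by exact_mod_cast hdA) (by push_cast; exact ha0),
    Int.cast_div (by exact_mod_cast hdB) (by push_cast; exact hb0)]
  push_cast
  field_simp

/-! ### The Rhin–Viola polynomial `S = X₀^j (1−X₀)^h X₁^k (1−X₁)^l (X₀(1−X₁) + X₁X₂)^e` -/

/-- Its evaluation at `(x, y, z)`. [cite: RhinViola2005, Lemma 2.2] -/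
theorem aeval_rvPoly (h j k l e : ℕ) (x y z : ℝ) :
    MvPolynomial.aeval ![x, y, z] (MvPolynomial.X 0 ^ j * (1 - MvPolynomial.X 0) ^ h * MvPolynomial.X 1 ^ k *
        (1 - MvPolynomial.X 1) ^ l *
        (MvPolynomial.X 0 * (1 - MvPolynomial.X 1) + MvPolynomial.X 1 * MvPolynomial.X 2) ^ e :
          MvPolynomial (Fin 3) ℤ) =
      x ^ j * (1 - x) ^ h * y ^ k * (1 - y) ^ l * (x * (1 - y) + y * z) ^ e := by
  simp

/-- Its partial degrees: `deg_x ≤ j + h + e` and `deg_y ≤ k + l + e` (RV: `deg_x S = m+h−k−1`,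
`deg_y S = l+m−j−1` for `e = m−j−k−1`). [cite: RhinViola2005, Lemma 2.2] -/
theorem degreeOf_rvPoly_le (h j k l e : ℕ) :
    (MvPolynomial.X 0 ^ j * (1 - MvPolynomial.X 0) ^ h * MvPolynomial.X 1 ^ k * (1 - MvPolynomial.X 1) ^ l *
        (MvPolynomial.X 0 * (1 - MvPolynomial.X 1) + MvPolynomial.X 1 * MvPolynomial.X 2) ^ e :
          MvPolynomial (Fin 3) ℤ).degreeOf 0 ≤ j + h + e ∧
    (MvPolynomial.X 0 ^ j * (1 - MvPolynomial.X 0) ^ h * MvPolynomial.X 1 ^ k * (1 - MvPolynomial.X 1) ^ l *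
        (MvPolynomial.X 0 * (1 - MvPolynomial.X 1) + MvPolynomial.X 1 * MvPolynomial.X 2) ^ e :
          MvPolynomial (Fin 3) ℤ).degreeOf 1 ≤ k + l + e := by
  have hX : ∀ i n : Fin 3, (MvPolynomial.X n : MvPolynomial (Fin 3) ℤ).degreeOf i = if i = n then 1 else 0 :=
    fun i n => MvPolynomial.degreeOf_X i n
  -- degree bounds of the five factors, in `x = X 0` (index `0`) and `y = X 1` (index `1`)
  have a1 : ∀ i : Fin 3, ((1 : MvPolynomial (Fin 3) ℤ) - MvPolynomial.X 0).degreeOf i ≤ if i = 0 then 1 else 0 :=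
    fun i => (MvPolynomial.degreeOf_sub_le _ _ _).trans (by rw [MvPolynomial.degreeOf_one, hX]; simp)
  have a2 : ∀ i : Fin 3, ((1 : MvPolynomial (Fin 3) ℤ) - MvPolynomial.X 1).degreeOf i ≤ if i = 1 then 1 else 0 :=
    fun i => (MvPolynomial.degreeOf_sub_le _ _ _).trans (by rw [MvPolynomial.degreeOf_one, hX]; simp)
  have a3 : ∀ i : Fin 3, i ≠ 2 → (MvPolynomial.X 0 * (1 - MvPolynomial.X 1) + MvPolynomial.X 1 * MvPolynomial.X 2 :
      MvPolynomial (Fin 3) ℤ).degreeOf i ≤ 1 := by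
    intro i hi
    refine (MvPolynomial.degreeOf_add_le _ _ _).trans (max_le ?_ ?_)
    · refine (MvPolynomial.degreeOf_mul_le _ _ _).trans ?_
      refine (Nat.add_le_add (le_of_eq (hX i 0)) (a2 i)).trans ?_
      fin_cases i <;> simp at hi ⊢
    · refine (MvPolynomial.degreeOf_mul_le _ _ _).trans ?_
      rw [hX, hX]
      fin_cases i <;> simp at hi ⊢
  have key : ∀ i : Fin 3, i ≠ 2 →
      (MvPolynomial.X 0 ^ j * (1 - MvPolynomial.X 0) ^ h * MvPolynomial.X 1 ^ k * (1 - MvPolynomial.X 1) ^ l *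
        (MvPolynomial.X 0 * (1 - MvPolynomial.X 1) + MvPolynomial.X 1 * MvPolynomial.X 2) ^ e :
          MvPolynomial (Fin 3) ℤ).degreeOf i ≤
        j * (if i = 0 then 1 else 0) + h * (if i = 0 then 1 else 0) + k * (if i = 1 then 1 else 0) +
          l * (if i = 1 then 1 else 0) + e * 1 := by
    intro i hi
    have e1 : (MvPolynomial.X 0 ^ j : MvPolynomial (Fin 3) ℤ).degreeOf i ≤ j * (if i = 0 then 1 else 0) :=
      (MvPolynomial.degreeOf_pow_le i _ j).trans (Nat.mul_le_mul_left j (le_of_eq (hX i 0)))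
    have e2 := (MvPolynomial.degreeOf_pow_le i _ h).trans (Nat.mul_le_mul_left h (a1 i))
    have e3 : (MvPolynomial.X 1 ^ k : MvPolynomial (Fin 3) ℤ).degreeOf i ≤ k * (if i = 1 then 1 else 0) :=
      (MvPolynomial.degreeOf_pow_le i _ k).trans (Nat.mul_le_mul_left k (le_of_eq (hX i 1)))
    have e4 := (MvPolynomial.degreeOf_pow_le i _ l).trans (Nat.mul_le_mul_left l (a2 i))
    have e5 := (MvPolynomial.degreeOf_pow_le i _ e).trans (Nat.mul_le_mul_left e (a3 i hi))
    have m1 := MvPolynomial.degreeOf_mul_le i (MvPolynomial.X 0 ^ j : MvPolynomial (Fin 3) ℤ)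
      ((1 - MvPolynomial.X 0) ^ h)
    have m2 := MvPolynomial.degreeOf_mul_le i (MvPolynomial.X 0 ^ j * (1 - MvPolynomial.X 0) ^ h :
      MvPolynomial (Fin 3) ℤ) (MvPolynomial.X 1 ^ k)
    have m3 := MvPolynomial.degreeOf_mul_le i
      (MvPolynomial.X 0 ^ j * (1 - MvPolynomial.X 0) ^ h * MvPolynomial.X 1 ^ k : MvPolynomial (Fin 3) ℤ)
      ((1 - MvPolynomial.X 1) ^ l)
    have m4 := MvPolynomial.degreeOf_mul_le i
      (MvPolynomial.X 0 ^ j * (1 - MvPolynomial.X 0) ^ h * MvPolynomial.X 1 ^ k * (1 - MvPolynomial.X 1) ^ l :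
        MvPolynomial (Fin 3) ℤ)
      ((MvPolynomial.X 0 * (1 - MvPolynomial.X 1) + MvPolynomial.X 1 * MvPolynomial.X 2) ^ e)
    omega
  constructor
  · simpa using key 0 (by decide)
  · simpa using key 1 (by decide)

/-! ### Lemma 2.2 for `I_z^{(0)}` -/

/-- **Rhin–Viola 2005, Lemma 2.2 (real member)**: if `j + k < m`, there is a polynomial `T ∈ ℤ[z]` with
`d_{m+h−k} d_{l+m−j} · z^{l+m} I_z^{(0)}(h,j,k,l,m) = T(z)` for every real `z ≥ 1`
(`I_z^{(1)}(h,j,k,l,m) = 0` in this case: `I1_of_lt`). [cite: RhinViola2005, Lemma 2.2] -/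
theorem exists_poly_eq_lcm_mul_zpow_mul_I0_of_lt {h j k l m : ℕ} (hm : j + k < m) :
    ∃ T : Polynomial ℤ, ∀ z : ℝ, 1 ≤ z → (Polynomial.aeval z T : ℝ) =
      (Nat.lcmUpto (m + h - k) : ℝ) * Nat.lcmUpto (l + m - j) * (z ^ ((l : ℤ) + m) * I0 z h j k l m) := by
  set e := m - (j + k + 1) with he
  obtain ⟨hdx, hdy⟩ := degreeOf_rvPoly_le h j k l e
  obtain ⟨T, hT⟩ := exists_poly_eq_lcm_mul_setIntegral_aeval
    (MvPolynomial.X 0 ^ j * (1 - MvPolynomial.X 0) ^ h * MvPolynomial.X 1 ^ k * (1 - MvPolynomial.X 1) ^ l *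
        (MvPolynomial.X 0 * (1 - MvPolynomial.X 1) + MvPolynomial.X 1 * MvPolynomial.X 2) ^ e :
          MvPolynomial (Fin 3) ℤ) (A := m + h - k) (B := l + m - j) (by omega) (by omega)
  refine ⟨T, fun z hz => ?_⟩
  rw [hT z, zpow_mul_I0_of_lt hz hm]
  congr 1
  refine setIntegral_congr_fun measurableSet_unitSquare fun p _ => ?_
  rw [aeval_rvPoly, denom₁]

end RhinViola

end Literature.NumberTheory.DiophantineApproximation

end
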